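import Summits.QuantumAdvantage.QuantumAdvantage.Theses.WhiteBoxWalk
import Literature.Computability.QuantumComplexity.CWrapAssembly
import Literature.Computability.Cryptography.ClassBQPComplementProofs
import Literature.Computability.Complexity.PlumbingBricks

/-!
# Crux `PlLift` (stmt-QuantumAdvantage-0250), line `certified-canonical-lift` — stub `stub_certify` (siege k8)

Registered stub `stub_certify : WbwCertifiedThesis → WbwCanonicalThesis` of the line skeleton
`Summits/QuantumAdvantage/QuantumAdvantage/Cruxes/PlLift/Lines/certified_canonical_lift.lean`
(sha `f97c9d33e600`; crux decl `Summit.QuantumAdvantage.QuantumAdvantage.Theses.PromiseLift.PlLift`, the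
same proposition as `WhiteBoxWalk.WbwPromiseLift`). Siege variation k8 ("certificate / decide on the finite
core"): the CERTIFICATE bit `V x` is folded into the quantum family by one classical wrap.

## Vocabulary (typed here so that a `Theorems/` file can state the stub; bodies VERBATIM from the skeleton)

The skeleton's two hypothesis-grade statements live only in the `Cruxes/` work file, which `Theorems/`
files cannot import. They are re-declared here byte-for-byte, in the skeleton's own namespace, tagged
`@[conjecture]` (open route-posited statements of OUR theories — conjecture-strength strengthenings of the
route target `WhiteBoxWalk.WbwThesis`, implied by nothing proved; NOTHING is asserted about them here):

* `WbwCanonicalThesis` (X_pd): planted unique-answer advantage with an EVERYWHERE-canonical solver;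
* `WbwCertifiedThesis` (X_cert): the same, canonicity only on a poly-time certified set `{x | V x}`
  containing every real instance `gen s`.

A lead integrating this file imports it and deletes the skeleton's local copies of the two `def`s and of
`theorem stub_certify` (same fully-qualified names; `Registered.stub_certify`, `PlLift_of`,
`wbwThesis_of_canonical/certified` elaborate unchanged). The constants being PUBLIC, a `Theorems/` file
for the sister stub `stub_canonical_lift : WbwCanonicalThesis → QuantumAdvantage` (and the re-cut of route
WhiteBoxWalk on `WbwCertifiedThesis` recommended by the line card) can state its signature against the same
two names by importing this module instead of copying the bodies again.

## The proof (plumbing over PROVED tree facts; no new machine)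

Given `(gen, ans, a, V, p)` certified, keep `gen`, `ans`, `p` and the classical-hardness clause (C) verbatim
and take the new answer map `a' x := if V x then a x else 0^{p |x|}` (`a' (gen s) = a (gen s) = ans s`
because `V (gen s) = true`; `|a' x| = p |x|` on both branches). The quantum clause for `a'` on EVERY input
(`isQSolvable_certify`):
1. the relation `R x := {y | V x = true → a x <+: y}` is solved by the GIVEN family — on a rejected `x` the
   event is the sure event (`QCircuitFamily.kernelProb_univ_eq_one`, pattern `bitProblem_mem_PromiseBQP` of
   `Theorems/WhiteBoxWalkWbwSearchToPromise.lean`);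
2. the tree's classical wrap `isQSolvable_classicalWrap_holds` (Bernstein–Vazirani 1997, §8) with the
   identity pre-processor and the certificate-gated post-processor
   `⟨x, y⟩ ↦ if V x then y else 0^{p |x|}` — the `FP` brick
   `iteFn ([V ·] ∘ fstF) sndF (Kannan.zerosFn ∘ Plumb.polyFn p ∘ fstF)` (`certifyPost_boolPair`,
   `certifyPost_mem_FP`) — outputs a string with prefix `a' x` whenever the inner sample lies in `R x`,
   i.e. with probability `≥ 2/3` on every `x` (`IsQSolvable.mono`).

References: E. Bernstein, U. Vazirani, SIAM J. Comput. 26 (1997) §8 (classical computation inside `BQP`);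
J. Watrous, *Quantum computational complexity* (2009) §III.2; O. Goldreich, *On promise problems* (2006) §1.1.
-/

noncomputable section

-- `Summit.<Summit>.<Problem>` is the mandated summit-side prefix; single-conjunct summit ⇒ `QuantumAdvantage.QuantumAdvantage`.
set_option linter.dupNamespace false

namespace Summit.QuantumAdvantage.QuantumAdvantage.Cruxes.PlLift.CertifiedCanonicalLift

open Filter Asymptotics
open Literature.Computability.Complexity Literature.Computability.Cryptography
open Summit.QuantumAdvantage.QuantumAdvantage.Theses

/-! ### Vocabulary of the line (verbatim from the skeleton; hypothesis-grade, nothing asserted) -/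

/-- **X_pd — planted unique-answer advantage with an EVERYWHERE-CANONICAL quantum solver** (statement of
line `certified-canonical-lift`, crux stmt-QuantumAdvantage-0250; body verbatim from the skeleton). As the
route's `WhiteBoxWalk.WbwThesis` (poly-time `gen`, answers `ans`, classical hardness (C) verbatim), but the
quantum clause is strengthened from "outputs `ans s` on input `gen s`" to: there is a total answer map `a`
with `a (gen s) = ans s`, `|a x| = p |x|`, and ONE uniform oracle-free Clifford+T family writes `a x` first
with probability `≥ 2/3` on EVERY input `x` (pseudo-deterministic everywhere, not only on the image of
`gen`; "pseudo-deterministic quantum search ⇔ reducible to a `BQP` decision LANGUAGE", arXiv:2602.17647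
Thm 1.7 as cited by the skeleton; Goldreich 2006 §1.1). OPEN (conjecture-strength: it implies the summit via
the line's `stub_canonical_lift`). -/
@[conjecture] def WbwCanonicalThesis : Prop :=
  ∃ (gen ans a : List Bool → List Bool) (p : Polynomial ℕ),
    Literature.Computability.Complexity.PolyTimeComputable id id gen ∧
    (∀ s, a (gen s) = ans s) ∧ (∀ x, (a x).length = p.eval x.length) ∧
    (∃ F : Literature.Computability.Cryptography.QCircuitFamily Literature.Computability.Cryptography.cliffordT,
      F.IsOracleFree ∧ F.IsUniform ∧ ∀ x, 2 / 3 ≤ F.kernelProb 0 x {y | a x <+: y}) ∧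
    ∀ A : Literature.Computability.Complexity.RandAlg (List Bool) (List Bool),
      Literature.Computability.Cryptography.IsPPT A id →
        Asymptotics.SuperpolynomialDecay atTop (fun n : ℕ => (n : ℝ)) (fun n : ℕ =>
          Literature.Computability.Cryptography.uniformAvg n fun s => A.pr id
            (Literature.Computability.Complexity.boolPair (Computability.unaryEncodeNat n) (gen s)) {y | ans s <+: y})

/-- **X_cert — CERTIFIED planting** (statement of line `certified-canonical-lift`, crux
stmt-QuantumAdvantage-0250; body verbatim from the skeleton). As `WbwCanonicalThesis`, but canonicity is only
required on a poly-time decidable instance set containing the image of `gen`: there is an instance verifier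
`V : {0,1}* → {0,1}` with `(x ↦ [V x]) ∈ FP`, `V (gen s) = true` for all seeds, and ONE uniform oracle-free
Clifford+T family that writes the canonical answer `a x` first with probability `≥ 2/3` on every input with
`V x = true` (nothing is required where `V x = false`). The shape delivered by absolutely sound one-message
certification of planted instances (Grollmann–Selman 1988, "injectivity supplies totality"; crypto form:
Bitansky–Paneth–Rosen FOCS 2015 §5, Bitansky ECCC TR17-005 §1.2). OPEN (hypothesis-grade S-half of the
line, `stub_certified_thesis`). -/
@[conjecture] def WbwCertifiedThesis : Prop :=
  ∃ (gen ans a : List Bool → List Bool) (V : List Bool → Bool) (p : Polynomial ℕ),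
    Literature.Computability.Complexity.PolyTimeComputable id id gen ∧
    (fun x => [V x]) ∈ Literature.Computability.Complexity.FP ∧ (∀ s, V (gen s) = true) ∧
    (∀ s, a (gen s) = ans s) ∧ (∀ x, (a x).length = p.eval x.length) ∧
    (∃ F : Literature.Computability.Cryptography.QCircuitFamily Literature.Computability.Cryptography.cliffordT,
      F.IsOracleFree ∧ F.IsUniform ∧ ∀ x, V x = true → 2 / 3 ≤ F.kernelProb 0 x {y | a x <+: y}) ∧
    ∀ A : Literature.Computability.Complexity.RandAlg (List Bool) (List Bool),
      Literature.Computability.Cryptography.IsPPT A id →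
        Asymptotics.SuperpolynomialDecay atTop (fun n : ℕ => (n : ℝ)) (fun n : ℕ =>
          Literature.Computability.Cryptography.uniformAvg n fun s => A.pr id
            (Literature.Computability.Complexity.boolPair (Computability.unaryEncodeNat n) (gen s)) {y | ans s <+: y})

open Brick

/-! ### The certificate-gated post-processor `⟨x, y⟩ ↦ if V x then y else 0^{p |x|}` -/

/-- Value of the certificate-gated post-processor on a pair: the measured string `y` when the verifier
accepts `x`, the all-zero word of length `p |x|` otherwise. [folklore] -/
theorem certifyPost_boolPair (V : List Bool → Bool) (p : Polynomial ℕ) (x y : List Bool) :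
    iteFn ((fun w => [V w]) ∘ fstF) sndF (Kannan.zerosFn ∘ Plumb.polyFn p ∘ fstF) (boolPair x y) =
      if V x then y else List.replicate (p.eval x.length) false := by
  rw [iteFn_apply (b := V x) (by simp)]
  cases V x <;> simp

/-- The certificate-gated post-processor is polynomial-time (an `iteFn` of `FP` bricks: the verifier bit
of the first component, the second component, zeros of the unary value `1^{p |x|}`).
[cite: AroraBarak2009, §1.3] -/
theorem certifyPost_mem_FP {V : List Bool → Bool} (hV : (fun w => [V w]) ∈ FP) (p : Polynomial ℕ) :
    iteFn ((fun w => [V w]) ∘ fstF) sndF (Kannan.zerosFn ∘ Plumb.polyFn p ∘ fstF) ∈ FP :=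
  iteFn_mem_FP (comp_mem_FP hV fstF_mem_FP) sndF_mem_FP
    (comp_mem_FP Kannan.zerosFn_mem_FP (comp_mem_FP (Plumb.polyFn_mem_FP p) fstF_mem_FP))

/-! ### Folding the verifier into the family -/

/-- **Certification ⇒ canonicity everywhere (search form).** If `(x ↦ [V x]) ∈ FP` and one uniform
oracle-free Clifford+T family writes `a x` first with probability `≥ 2/3` on every `V`-accepted input,
then the total answer map `x ↦ if V x then a x else 0^{p |x|}` is solvable in bounded-error quantum
polynomial time on EVERY input: the relation "prefix `a x` if `V x`, anything otherwise" is solved by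
the given family (off the certified set the event is the sure event), and the classical wrap with the
identity pre-processor and the certificate-gated post-processor turns its samples into the canonical
answer. [cite: BernsteinVazirani1997, §8 (classical computation inside quantum machines)] -/
theorem isQSolvable_certify {a : List Bool → List Bool} {V : List Bool → Bool} (p : Polynomial ℕ)
    (hV : (fun w => [V w]) ∈ FP)
    (hQ : ∃ F : QCircuitFamily cliffordT, F.IsOracleFree ∧ F.IsUniform ∧
      ∀ x, V x = true → 2 / 3 ≤ F.kernelProb 0 x {y | a x <+: y}) :
    IsQSolvable fun x => {z | (if V x then a x else List.replicate (p.eval x.length) false) <+: z} := by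
  -- the certified relation: the canonical answer on accepted inputs, anything elsewhere
  have hR : IsQSolvable fun x => {y | V x = true → a x <+: y} := by
    obtain ⟨F, hF, hU, hK⟩ := hQ
    refine ⟨F, hF, hU, fun x => ?_⟩
    show 2 / 3 ≤ F.kernelProb 0 x {y | V x = true → a x <+: y}
    cases hx : V x with
    | true =>
      have hset : {y : List Bool | true = true → a x <+: y} = {y | a x <+: y} := by
        ext y; simp
      rw [hset]
      exact hK x hx
    | false =>
      have hset : {y : List Bool | false = true → a x <+: y} = Set.univ := by
        ext y; simp
      rw [hset, QCircuitFamily.kernelProb_univ_eq_one]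
      norm_num
  -- wrap: identity pre-processor, certificate-gated post-processor; then shrink the event
  refine (isQSolvable_classicalWrap_holds id _ (PolyTimeComputable.id _) (certifyPost_mem_FP hV p) hR).mono
    fun x => ?_
  rintro z ⟨y, hy, hz⟩
  rw [certifyPost_boolPair] at hz
  simp only [id, Set.mem_setOf_eq] at hy
  simp only [Set.mem_setOf_eq]
  cases hx : V x with
  | true =>
    rw [hx] at hz
    simp only [if_true] at hz ⊢
    exact (hy hx).trans hz
  | false =>
    rw [hx] at hz
    simpa using hz

/-! ### The stub -/

/-- **Stub `stub_certify`** of line `certified-canonical-lift` (crux `PlLift`, stmt-QuantumAdvantage-0250;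
registered signature `WbwCertifiedThesis → WbwCanonicalThesis`): certified planting ⇒ everywhere-canonical
planting. Keep `gen`, `ans`, `p` and the classical-hardness clause (C) verbatim; replace the answer map by
`a' x := if V x then a x else 0^{p |x|}` (it agrees with `ans` on the image of `gen` because
`V (gen s) = true`, and has length `p |x|` everywhere) and the family by the certificate-gated classical
wrap of `isQSolvable_certify`. [cite: BernsteinVazirani1997, §8] -/
theorem stub_certify : WbwCertifiedThesis → WbwCanonicalThesis := by
  rintro ⟨gen, ans, a, V, p, hgen, hVFP, hV, hag, hlen, hQ, hC⟩
  refine ⟨gen, ans, fun x => if V x then a x else List.replicate (p.eval x.length) false, p, hgen,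
    fun s => ?_, fun x => ?_, isQSolvable_certify p hVFP hQ, hC⟩
  · simp only [hV s, if_true, hag s]
  · dsimp only
    split_ifs
    · exact hlen x
    · exact List.length_replicate ..

end Summit.QuantumAdvantage.QuantumAdvantage.Cruxes.PlLift.CertifiedCanonicalLift

end
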